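/- Copyright: the b2b-balaban cell (near-miss cell 7), T⁴-continuum fan-out, NE7b swarm leaf 04 (gen 6; road W-RP, sub-row
«W3l»: the K-fold tower law `(U, Ū, …, Ū^k)` by induction on the level).  Released under the licence of the surrounding
project. -/
import Summits.QuantumFields.BalabanUV.T4Continuum.Support.HistoryRPTower

/-!
# History chessboard road: the TOWER LAW `(U, Ū, Ū², …, Ū^k)` is reflection positive at the centre cuts (W3l)

Summits-side support leaf of the T⁴-continuum cell (rung (B)+1 on a FINITE torus only; NOT infinite volume, NOT the
mass gap, NOT the Clay statement; NOT a proof of the spine estimate NE7b).  Road W-RP (R-OWNER-23-2 ∕ R-OWNER-23-8) of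
the swarm claim table `t4/b2b-balaban-t4-ne7b-p1/LEAVES-NE7b.md`, sub-row «W3l» (journal INTENT of leaf-04 g6; owner
l.15147 «iterate over levels only if cheap»), on top of W3j (`HistoryRPTower.rpPackage_towerStep`) and W3h
(`HistoryRPGibbs`, leaf-06 g5).  [folklore] packaging by structural recursion on the level; DATA defs `Tower`, `last`,
`towerLaw`, `towerPos`, `towerRefl` (+ the `MeasurableSpace` instance of `Tower`); no `structure`, no `[cite:]` tag, no
`Prop`-valued definition (c1), no constant (c2∕c6), no exit ∕ socket ∕ `HistoryConstants` file (c3).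

WHAT.
* §1 THE TOWER by structural recursion: `Tower P G 0 := GaugeField P 0 G`, `Tower P G (k+1) := Tower P G k × GaugeField
  P (k+1) G` (all of Bałaban's averaged fields of levels `0, …, k` jointly), its measurable structure, the projection
  `last` onto the top field, the LAW `towerLaw μ av k` (push the level-`k` law forward along `ω ↦ (ω, (av k).avg (last ω))`),
  the POSITIVE ALGEBRA `towerPos G ρ k` (positive bonds of every level `≤ k`), the REFLECTION `towerRefl ρ k` (`c_ρ` on every
  level); `last_towerRefl`, `measurable_last`, `measurable_last_pos`, `isFiniteMeasure_towerLaw`.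
* §2 **`rpPackage_towerLaw`**: for a family `av k : Setup.Averaging P k G` of measurable, two-block-local, centre-equivariant
  averagings and a base state `μ` at level `0` with the two base binders (`MeasurePreserving (creflect ρ) μ μ`,
  `IsReflectionPositiveBdd μ (mPos G 0 ρ) (creflect ρ)`), EVERY level `k ≤ m + K` of the tower carries the five-member
  RP-package `(towerLaw μ av k, towerPos G ρ k, towerRefl ρ k)` — induction on `k` with W3j's `rpPackage_towerStep`
  (`Ω := Tower P G k`, `π := last`).  `rpPackage_towerLaw_blockAvg` for Bałaban's (0.4) at every level (`ℰ k`).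
* §3 **`isReflectionPositiveBdd_towerLaw_gibbs_SU`**: the `SU(n)` Wilson–Gibbs state at level 0 (W3h's
  `rpPackage_gibbs_creflect_SU`) ⇒ the tower law of its block averages is reflection positive at the centre cut of every
  axis at EVERY level `k ≤ m + K` — hypothesis-free up to `0 ≤ β` and measurable small-loop averages.

HONEST SCOPE.  Packaging∕induction over TREE theorems; centre cuts only (translated cuts: W3k's pattern applies level by
level, not done here); (EXT)∕(LOC)-for-events, (R-sym), (U1)∕(G2) and the identification of W4b′'s per-cutoff carrier
`Ω K` with `Tower P G K` ∕ its state with `towerLaw` stay the instantiating seat's sentences; the typing identification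
«`blockAvg ℰ` is Bałaban's (0.4)» is T-class.  NE7b NOT proved; spine 0∕9.  HONEST DEPENDENCY (cell): continuum YM on T⁴
⇐ BetaPertH ∧ nine spine estimates (0/9 proved); BetaPertH ⇐ (D1) ∧ (D4) ∧ CAP+tail; G-an2-4 gates asym, D1 and NE2/3/4.
This file changes none of it. -/

open MeasureTheory ProbabilityTheory
open Literature.MathematicalPhysics.QuantumFieldTheory
open Literature.MathematicalPhysics.QuantumFieldTheory.Balaban1983to89
open Literature.MathematicalPhysics.QuantumFieldTheory.LatticeRP (IsReflectionPositiveBdd)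
open BlockAveraging T4ReflectionConeSharp
open Summit.QuantumFields.BalabanUV.T4Continuum.HistoryRPHalfTorus
open Summit.QuantumFields.BalabanUV.T4Continuum.HistoryRPAveraging
open Summit.QuantumFields.BalabanUV.T4Continuum.HistoryRPTwoLevel
open Summit.QuantumFields.BalabanUV.T4Continuum.HistoryRPTower

namespace Summit.QuantumFields.BalabanUV.T4Continuum.HistoryRPTowerLaw

noncomputable section

/-! ## §1 The tower, its law, positive algebra and reflection -/

section Tower

variable (P : Params) (G : Type*)

/-- **THE TOWER CARRIER**: the averaged fields of levels `0, …, k` jointly, by structural recursion. -/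
def Tower : ℕ → Type _
  | 0 => GaugeField P 0 G
  | k + 1 => Tower k × GaugeField P (k + 1) G

/-- the measurable structure of the tower (product σ-algebras, by recursion). -/
instance instMeasurableSpaceTower [MeasurableSpace G] : (k : ℕ) → MeasurableSpace (Tower P G k)
  | 0 => (inferInstance : MeasurableSpace (GaugeField P 0 G))
  | k + 1 => @Prod.instMeasurableSpace (Tower P G k) (GaugeField P (k + 1) G) (instMeasurableSpaceTower k) inferInstance

variable {P G}

/-- **THE TOP FIELD** of a tower point. -/
def last : (k : ℕ) → Tower P G k → GaugeField P k G
  | 0 => fun U => U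
  | _ + 1 => fun ω => ω.2

section Measurable

variable [MeasurableSpace G]

/-- `last` is measurable. [folklore] -/
theorem measurable_last : ∀ k : ℕ, Measurable (last (P := P) (G := G) k)
  | 0 => measurable_id
  | _ + 1 => measurable_snd

/-- **THE POSITIVE ALGEBRA OF THE TOWER**: the positive bonds of every level `≤ k`. -/
@[reducible] def towerPos (G : Type*) [MeasurableSpace G] (ρ : Fin P.d) : (k : ℕ) → MeasurableSpace (Tower P G k)
  | 0 => mPos G 0 ρ
  | k + 1 => (towerPos G ρ k).prod (mPos G (k + 1) ρ)

/-- `last` reads positive data positively. [folklore] -/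
theorem measurable_last_pos (ρ : Fin P.d) :
    ∀ k : ℕ, @Measurable _ _ (towerPos G ρ k) (mPos G k ρ) (last (P := P) (G := G) k)
  | 0 => fun _ hs => hs
  | k + 1 => @measurable_snd _ _ (towerPos G ρ k) (mPos G (k + 1) ρ)

/-- the tower's positive algebra is a sub-σ-algebra. [folklore] -/
theorem towerPos_le (ρ : Fin P.d) :
    ∀ k : ℕ, towerPos G ρ k ≤ (instMeasurableSpaceTower P G k : MeasurableSpace (Tower P G k))
  | 0 => mPos_le G 0 ρ
  | k + 1 => prod_le_prod (towerPos_le ρ k) (mPos_le G (k + 1) ρ)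

end Measurable

variable [GaugeGroup G]

/-- **THE TOWER REFLECTION**: the centre reflection `c_ρ` on every level. -/
def towerRefl (ρ : Fin P.d) : (k : ℕ) → Tower P G k → Tower P G k
  | 0 => GaugeField.creflect ρ
  | k + 1 => Prod.map (towerRefl ρ k) (GaugeField.creflect ρ)

/-- the top field of the reflected tower point is the reflected top field. [folklore] -/
theorem last_towerRefl (ρ : Fin P.d) : ∀ (k : ℕ) (ω : Tower P G k),
    last k (towerRefl ρ k ω) = (last k ω).creflect ρ
  | 0, _ => rfl
  | _ + 1, _ => rfl

/-- the tower reflection is an involution. [folklore] -/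
theorem towerRefl_comp_self (ρ : Fin P.d) : ∀ k : ℕ, towerRefl (P := P) (G := G) ρ k ∘ towerRefl ρ k = id
  | 0 => creflect_comp_self ρ
  | k + 1 => by
    funext ω
    obtain ⟨ω', V⟩ := ω
    show (towerRefl ρ k (towerRefl ρ k ω'), GaugeField.creflect ρ (GaugeField.creflect ρ V)) = (ω', V)
    rw [creflect_creflect, show towerRefl ρ k (towerRefl ρ k ω') = ω' from congrFun (towerRefl_comp_self ρ k) ω']

variable [MeasurableSpace G]

/-- the tower reflection is measurable. [folklore] -/
theorem measurable_towerRefl [MeasurableInv G] (ρ : Fin P.d) : ∀ k : ℕ, Measurable (towerRefl (P := P) (G := G) ρ k)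
  | 0 => measurable_creflect ρ
  | k + 1 => (measurable_towerRefl ρ k).prodMap (measurable_creflect ρ)

variable (μ : Measure (GaugeField P 0 G)) (av : (k : ℕ) → Averaging P k G)

/-- **THE TOWER LAW**: the law of `(U, Ū, …, Ū^k)` — the level-`k` law pushed forward along «append the next average
of the top field». -/
def towerLaw : (k : ℕ) → Measure (Tower P G k)
  | 0 => μ
  | k + 1 => (towerLaw k).map fun ω => (ω, (av k).avg (last k ω))

/-- the tower law is finite when the base is. [folklore] -/
instance isFiniteMeasure_towerLaw [IsFiniteMeasure μ] : (k : ℕ) → IsFiniteMeasure (towerLaw μ av k)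
  | 0 => (inferInstance : IsFiniteMeasure μ)
  | k + 1 => @Measure.isFiniteMeasure_map _ _ _ _ (towerLaw μ av k) (isFiniteMeasure_towerLaw k) _

end Tower

/-! ## §2 Every level of the tower carries the RP-package -/

section Package

variable {P : Params} {G : Type*} [GaugeGroup G] [MeasurableSpace G]

/-- **THE TOWER LAW IS REFLECTION POSITIVE AT THE CENTRE CUT, AT EVERY LEVEL** (abstract averagings): for a family of
measurable, two-block-local, centre-reflection-equivariant one-step averagings `av k` and a base state `μ` at level `0`
that is `c_ρ`-invariant and reflection positive for the positive fine bonds, every level `k ≤ m + K` of the tower carries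
the five-member RP-package `(towerLaw μ av k, towerPos G ρ k, towerRefl ρ k)` — induction on `k` with W3j's
`rpPackage_towerStep` (`Ω := Tower P G k`, `π := last k`). [folklore] -/
theorem rpPackage_towerLaw [MeasurableInv G] (ρ : Fin P.d) {av : (k : ℕ) → Averaging P k G}
    (hA : ∀ k, Measurable (av k).avg) (hL : ∀ k, TwoBlockLocal (av k))
    (hR : ∀ k (U : GaugeField P k G), (av k).avg (U.creflect ρ) = ((av k).avg U).creflect ρ)
    {μ : Measure (GaugeField P 0 G)} [IsFiniteMeasure μ]
    (hθ : MeasurePreserving (GaugeField.creflect ρ) μ μ)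
    (hRP : IsReflectionPositiveBdd μ (mPos G 0 ρ) (GaugeField.creflect ρ)) :
    ∀ k : ℕ, k ≤ P.m + P.K →
      towerPos G ρ k ≤ (instMeasurableSpaceTower P G k : MeasurableSpace (Tower P G k)) ∧
        Measurable (towerRefl (P := P) (G := G) ρ k) ∧
        MeasurePreserving (towerRefl ρ k) (towerLaw μ av k) (towerLaw μ av k) ∧
        towerRefl (P := P) (G := G) ρ k ∘ towerRefl ρ k = id ∧
        IsReflectionPositiveBdd (towerLaw μ av k) (towerPos G ρ k) (towerRefl ρ k)
  | 0, _ => ⟨mPos_le G 0 ρ, measurable_creflect ρ, hθ, creflect_comp_self ρ, hRP⟩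
  | k + 1, hk => by
    obtain ⟨hle, hΘm, hΘ, hΘΘ, h5⟩ := rpPackage_towerLaw ρ hA hL hR hθ hRP k (Nat.le_of_succ_le hk)
    exact rpPackage_towerStep (Ω := Tower P G k) (mQ := towerPos G ρ k) ρ (last k) hk (hA k) (hL k) (hR k)
      (measurable_last k) (measurable_last_pos ρ k) (last_towerRefl ρ k) hle hΘm hΘ hΘΘ h5

/-- **THE TOWER LAW OF BAŁABAN'S BLOCK AVERAGINGS (0.4) IS REFLECTION POSITIVE AT EVERY LEVEL** (tree `blockAvg (ℰ k)`,
any measurable small-loop averages; (LOC) by `twoBlockLocal_blockAvg`, (γ) by `blockAvg_creflect`). [folklore] -/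
theorem rpPackage_towerLaw_blockAvg [RegularGaugeGroup G] (ρ : Fin P.d) (ℰ : ℕ → LoopAverage G)
    (hE : ∀ k n, Measurable fun W : Fin (n + 1) → G => (ℰ k).E W)
    {μ : Measure (GaugeField P 0 G)} [IsFiniteMeasure μ]
    (hθ : MeasurePreserving (GaugeField.creflect ρ) μ μ)
    (hRP : IsReflectionPositiveBdd μ (mPos G 0 ρ) (GaugeField.creflect ρ)) (k : ℕ) (hk : k ≤ P.m + P.K) :
    towerPos G ρ k ≤ (instMeasurableSpaceTower P G k : MeasurableSpace (Tower P G k)) ∧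
      Measurable (towerRefl (P := P) (G := G) ρ k) ∧
      MeasurePreserving (towerRefl ρ k) (towerLaw μ (fun k => blockAvg (P := P) (j := k) (ℰ k)) k)
        (towerLaw μ (fun k => blockAvg (P := P) (j := k) (ℰ k)) k) ∧
      towerRefl (P := P) (G := G) ρ k ∘ towerRefl ρ k = id ∧
      IsReflectionPositiveBdd (towerLaw μ (fun k => blockAvg (P := P) (j := k) (ℰ k)) k) (towerPos G ρ k)
        (towerRefl ρ k) :=
  rpPackage_towerLaw ρ (fun k => measurable_avgFun (ℰ k) (hE k)) (fun k => twoBlockLocal_blockAvg (ℰ k))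
    (fun k U => blockAvg_creflect (ℰ k) ρ U) hθ hRP k hk

end Package

/-! ## §3 The `SU(n)` Wilson–Gibbs state at level 0 -/

section Gibbs

variable {n : ℕ} [NeZero n]

/-- **UNDER THE `SU(n)` WILSON–GIBBS STATE ON BAŁABAN'S FINEST TORUS, THE TOWER LAW `(U, Ū, …, Ū^k)` OF ITS BLOCK
AVERAGES (0.4) IS REFLECTION POSITIVE AT THE CENTRE CUT OF EVERY AXIS, AT EVERY LEVEL `k ≤ m + K`** — hypothesis-free up
to `0 ≤ β` and measurable small-loop averages (base package: W3h's `rpPackage_gibbs_creflect_SU`). [folklore] -/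
theorem isReflectionPositiveBdd_towerLaw_gibbs_SU (P : Params) {β : ℝ} (hβ : 0 ≤ β) (ρ : Fin P.d)
    (ℰ : ℕ → LoopAverage (Matrix.specialUnitaryGroup (Fin n) ℂ))
    (hE : ∀ k l, Measurable fun W : Fin (l + 1) → Matrix.specialUnitaryGroup (Fin n) ℂ => (ℰ k).E W)
    (k : ℕ) (hk : k ≤ P.m + P.K) :
    IsReflectionPositiveBdd
      (towerLaw (T4GenFunBounds.gibbsMeasure (G := Matrix.specialUnitaryGroup (Fin n) ℂ) P β)
        (fun k => blockAvg (P := P) (j := k) (ℰ k)) k)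
      (towerPos (Matrix.specialUnitaryGroup (Fin n) ℂ) ρ k) (towerRefl ρ k) := by
  haveI := T4GenFunBounds.isProbabilityMeasure_gibbsMeasure (G := Matrix.specialUnitaryGroup (Fin n) ℂ) P hβ
  obtain ⟨-, -, hθ, -, hRP⟩ := HistoryRPGibbs.rpPackage_gibbs_creflect_SU (n := n) P hβ ρ
  exact (rpPackage_towerLaw_blockAvg ρ ℰ hE hθ hRP k hk).2.2.2.2

end Gibbs

end

end Summit.QuantumFields.BalabanUV.T4Continuum.HistoryRPTowerLaw
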